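import Summits.BirchSwinnertonDyer.BirchSwinnertonDyer.Theses.AdditiveBranchIMC
import Summits.BirchSwinnertonDyer.BirchSwinnertonDyer.Theorems.SchneiderFreeSocketsV2
import Summits.BirchSwinnertonDyer.BirchSwinnertonDyer.Theorems.SchneiderFreeUpperSockets
import Literature.NumberTheory.EllipticCurves.Rank1Residual.Typed.JointLower
import Literature.NumberTheory.EllipticCurves.NonvanishingTwistsPrescribedRamificationSimpleZero
import Literature.NumberTheory.EllipticCurves.NonvanishingTwistsHoffsteinLuo
import Literature.NumberTheory.EllipticCurves.BSDQuadraticDescent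
import Literature.NumberTheory.EllipticCurves.BSDRootNumber
import Literature.NumberTheory.EllipticCurves.GrossZagierRationalPoint
import Literature.NumberTheory.EllipticCurves.LeadingTerm
import Literature.NumberTheory.EllipticCurves.Tamagawa
import Literature.NumberTheory.EllipticCurves.Hsieh2014.AnticyclotomicPAdicLFunctionRamifiedSteinberg
import Literature.NumberTheory.EllipticCurves.LiuZhangZhang2018.PAdicWaldspurgerEllipticCurveAdditiveRamifiedSteinberg
import Literature.NumberTheory.EllipticCurves.CaiShuTian2014.ExplicitGrossZagier
import Literature.NumberTheory.EllipticCurves.CaiShuTian2014.ExplicitGrossZagierRingClass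
import Literature.NumberTheory.EllipticCurves.Voight2007.RingClassGenusField
import Literature.NumberTheory.EllipticCurves.ManinConstantSemistablePrimewise
import Summits.BirchSwinnertonDyer.BirchSwinnertonDyer.Theorems.SchneiderFreeAdditiveX3BranchIMCRebaseHeight
import Literature.NumberTheory.EllipticCurves.Gross2004.RationalCharacterLSeries
import Literature.NumberTheory.EllipticCurves.BSDQuadraticDescentShaOddPartGeneralProofs
import Literature.NumberTheory.EllipticCurves.BSDQuadraticDescentTorsionOddPartProofs
import HarnessLib
import Summits.BirchSwinnertonDyer.BirchSwinnertonDyer.Theorems.SchneiderFreeUpperSocketsSplit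
import Literature.NumberTheory.EllipticCurves.MatarNekovar2019.ShaStructureIrreducible
import Literature.NumberTheory.EllipticCurves.ManinConstantQuadraticTwistIstarProofs
import Summits.BirchSwinnertonDyer.BirchSwinnertonDyer.Theorems.AdditiveBranchIMCGordTwoRankOneHeegnerKolyvaginIstarDoorsCells
import Literature.NumberTheory.EllipticCurves.KolyvaginShaIndexBound

/-!
# Line `twist_unit_road` (v2) — crux `GordTwoRankZeroOffCaseOne` (item stmt-BirchSwinnertonDyer-19357,
# route `AdditiveBranchIMC` = K1), planner pen bsd-addord-plan gen 37, 2026-08-28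

A SECOND registered line on the crux, beside `three_field_road` (v4, LEAD cruxlead-19357). It keeps the
three-field road's FIELD 1 (the tame road with the ranks swapped: a Heegner field `K` with ONE ramified
Wan prime `q ∥ N_E`, `p` inert, the rank-one twist `Wd = E^{(d_K)}_min`, and the JOINT LOWER half
`ord_p #Ш_an(E) + ord_p #Ш_an(Wd) ≤ ord_p #Ш(E) + ord_p #Ш(Wd)`) and REPLACES its fields 2–3 (the
`p`-ramified Kolyvagin field `K″`, the genus Heegner system, the non-printed `p`-exact GENUS Kolyvagin
bound U-b and the Skinner–Urban partner) by the programme's TWIST-UNIT LEVER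
(`SchneiderFree.Upper.missingUpperBoundAt_of_jointUpper_of_twistUnit`, cell bsd-schneider-ideate; the
`p = 3` road `RamifiedHeegnerPair…LeafRankOneUpperAtThreeTwistUnit` §2–§3, seat rhp-p2 g7):

* UPPER(`Wd`) ⟸ a `p`-SPLIT strict Heegner field `K‴ = ℚ(√d)` for `N_{Wd}` (every prime of `N_{Wd}`
  split — `p² ∣ N_{Wd}` is allowed by the strict hypothesis) whose rank-zero partner `B = Wd^{(d)}_min`
  has `ord_p #Ш_an(B) ≤ 0` (a TWIST-UNIT datum, `TwistUnitSupplyDatum Wd p` below), by PRINT BY NAME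
  (v2: this port is the cell's tree theorem, see below): Gross–Zagier ∀, Kolyvagin ∀ (finiteness), GZK,
  Version L, GZ I.(7.3), Matar–Nekovář 2019 Thm 0.7 in the IRREDUCIBLE form (`ρ̄_{Wd,p}` is onto on the
  sub-row; strict Heegner hypothesis; `d ∉ {−3, −4}`), Cassels' isogeny invariance, and Manin at the
  additive prime `p` (Kodaira `I₀*` at `p`: the tree theorem `not_dvd_maninConstant_of_kodairaSymbolAt_eq_Istar`
  from Mazur + Abbes–Ullmo + Česnavičius, transported along a prime-to-`p` isogeny) — NO lower bound for
  the partner is needed (`0 ≤ ord_p #Ш(B)` is free), so LEAD report 1 §3's circularity does not arise.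
* The line's ONE non-printed input is the SUPPLY `stub_twistUnitSupply`: every rank-one (G-ord, `e = 2`)
  curve with `ρ̄` onto and `p ≥ 5` HAS a twist-unit datum. Class-wide this is a mod-`p` non-vanishing
  statement for the Heegner twists of a fixed curve at an ADDITIVE prime `p` — Ono–Skinner 1998
  (Ann. Math. 147, arXiv:math/9611225) Cor. 2/4 and the survey's Cor. 5 give exactly this for all primes
  `ℓ` outside an effectively determinable finite set, but their (L1)–(L2) require `ℓ ∤ 4N` (level) and
  `ℓ > 2(k+2)`, so `ℓ = p ∣ N_{Wd}` is EXCLUDED: not in print on these rows. Per pair it is a finite exact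
  certificate (modular symbols / `#Ш_an` of one twist), as in the `p = 3` TU census of route
  `RamifiedHeegnerPair` (seat bsd-trib-w-rhp g11).

So the crux closes on the sub-row modulo `PrintedFactsTU ∧ stub_twistUnitSupply ∧ stub_tameJointLowerR0`
(the latter shared verbatim with `three_field_road`), versus `three_field_road`'s
`PrintedFactsR0 ∧ GenusKolyvaginLeaves ∧ stub_tameJointLowerR0`: the residual moves from a transported
Kolyvagin-system construction (programme-sized formalisation, LeadReport1 §5) to an analytic supply
statement with per-pair certificates. BSD is not proved by any of this; nothing is asserted.

v2 (same day, 19:5xZ) — THE PRINT PORT IS ALREADY IN THE TREE. v1's `stub_upperOfTwistUnit` (UPPER(`Wd`) from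
a twist-unit datum + print) is DISCHARGED here, sorry-free, by the cell's own Part 23b/23c (lane k1-c3x gen 6,
crux 19358): `AdditiveBranchIMCGordTwoRankOne.HeegnerKolyvagin.missingUpperBoundAt_rankOne_cellGordTwo_odd_of_twistShaAnUnit`
(UPPER(E,p) on cell (G-ord, `e = 2`) ∩ `r_an = 1`, every odd `p`, `ρ̄` onto, `p ∤ ∏c`, from PUB = Gross–Zagier ∀,
Kolyvagin ∀, Kolyvagin 1990 Thm A / McCallum 1991 §1 (`Kolyvagin1990_padicValNat_card_sha_le`, the `p`-EXACT
classical bound over a STRICT Heegner field — binders allow `p² ∣ N`), GZK, Version L, `exists_isNewformOf`,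
Mazur / Abbes–Ullmo / Česnavičius — and ONE Heegner twist with `L ≠ 0` and `ord_p #Ш_an ≤ 0`; Kodaira `Iₙ*` at `p`
by `N10.exists_kodairaSymbolAt_eq_Istar_of_cellGordTwo`, Manin-good datum by `exists_maninDatum_of_istar_of_irr`).
Accordingly `PrintedFactsTU` gains the LAST conjunct `∀ N W K, Kolyvagin1990_padicValNat_card_sha_le N W K`, the
datum drops its unused clauses `Odd d`, `d < −4` (the door handles `#𝓞_K^×` by `not_dvd_unitsTorsionOrder_of_heegner`),
and the line's own open content is EXACTLY ONE statement beyond the shared field 1: the SUPPLY.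

Registered stubs (5): `stub_residualR0` [XL; verbatim the sibling line's], `stub_printedFactsTU` [cite-only],
`stub_fieldSupplyTU` [M; FIELD 1 only = the first six clauses of `ThreeFieldRoad.stub_fieldSupplyR0`],
`stub_tameJointLowerR0` [XL; verbatim the sibling line's, one proof closes both], `stub_twistUnitSupply`
[XL; THE RESIDUAL, open class-wide, per-pair decidable]. PROVED here: `upperOfTwistUnit_of_print` (v1's sixth
stub) and the composition `GordTwoRankZeroOffCaseOne_of`, which concludes the crux BY NAME.
-/

set_option autoImplicit false
set_option linter.dupNamespace false

namespace Summit.BirchSwinnertonDyer.BirchSwinnertonDyer.Cruxes.GordTwoRankZeroOffCaseOne.TwistUnitRoad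

open scoped Classical

open NumberField IsDedekindDomain
open WeierstrassCurve Literature.NumberTheory.EllipticCurves
  Literature.NumberTheory.EllipticCurves.ModularForms
  Literature.NumberTheory.EllipticCurves.Rank1Residual
  Literature.NumberTheory.EllipticCurves.Rank1Residual.Typed

open Summit.BirchSwinnertonDyer.Rank1Residual
open Summit.BirchSwinnertonDyer.Rank1Residual.Additive
open Summit.BirchSwinnertonDyer.BirchSwinnertonDyer.Theses.AdditiveBranchIMC
open Summit.BirchSwinnertonDyer.BirchSwinnertonDyer.Theorems
open Summit.BirchSwinnertonDyer.BirchSwinnertonDyer.Theorems.SchneiderFree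
/-! ### Vocabulary (defs, nothing asserted; `WanPrime`, `TameRoadRow`, `ThreeFieldRow`, `TameRoadField`, `PrintedFactsR0`
VERBATIM from the sibling line `three_field_road` v4 — copied, not imported, so that this line does not
depend on the sibling module's future rewrites; the copies are definitionally equal to the sibling's) -/

/-- The WAN PRIME: `q ≠ p`, `q ≠ 2`, NON-SPLIT multiplicative for `E` (`a_q = −1`), `ρ̄_{E,p}` ramified at
`q` (`p ∤ v_q(Δ_min)`). On this road it serves three times: ramified in the tame-road field `K` (Hsieh's
Hypothesis A, parity), ramified in the Kolyvagin field `K″` the same way (`K″_q = K_q`), and as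
Skinner–Urban's (ram) prime for the good partner `A` (which is again non-split multiplicative at `q`).
[predicate; nothing asserted] -/
def WanPrime (W : WeierstrassCurve ℚ) [W.IsGloballyMinimal] (p q : ℕ) [Fact q.Prime] : Prop :=
  q ≠ p ∧ q ≠ 2 ∧ W.HasMultiplicativeReductionAtPrime q ∧ ¬ W.HasSplitMultiplicativeReductionAtPrime q ∧
    ¬ p ∣ padicValInt q W.minimalDiscriminantInt

/-- The tame sub-row (v3, verbatim): `p ≥ 5`, `ρ̄_{E,p}` onto, `E` semistable outside `p`, a Wan prime.
[predicate; nothing asserted] -/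
def TameRoadRow (W : WeierstrassCurve ℚ) [W.IsGloballyMinimal] (p : ℕ) [Fact p.Prime] : Prop :=
  5 ≤ p ∧ Surj W p ∧
    (∀ ℓ : ℕ, (hℓ : ℓ.Prime) → ℓ ≠ p →
      (haveI : Fact ℓ.Prime := ⟨hℓ⟩;
        W.HasGoodReductionAtPrime ℓ ∨ W.HasMultiplicativeReductionAtPrime ℓ)) ∧
    ∃ q : ℕ, ∃ _ : Fact q.Prime, WanPrime W p q

/-- THE SUB-ROW OF THIS LINE: the tame sub-row with the Tamagawa row condition `p ∤ ∏_ℓ c_ℓ(E)`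
(for `p ≥ 5` this only says `p ∤ v_ℓ(Δ)` at the SPLIT multiplicative primes `ℓ ≠ q`; it makes
Kolyvagin's index bound over `K″` `p`-exact — barrier `StringentKolyvaginCapsAtMax` is not challenged).
[predicate; nothing asserted] -/
def ThreeFieldRow (W : WeierstrassCurve ℚ) [W.IsGloballyMinimal] (p : ℕ) [Fact p.Prime] : Prop :=
  TameRoadRow W p ∧ ¬ p ∣ W.tamagawaProduct

/-- The TAME-ROAD FIELD at `(E, p)` (v3, verbatim = the local data of F6): imaginary quadratic `K`, a
Wan prime `q` ramified, every other prime of `N_E` split, `2` split if `2 ∤ N_E`, `p` split.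
[predicate; nothing asserted] -/
def TameRoadField (W : WeierstrassCurve ℚ) [W.IsGloballyMinimal] (p : ℕ)
    (K : Type) [Field K] [NumberField K] : Prop :=
  IsImaginaryQuadratic K ∧
    (∃ q : ℕ, ∃ _ : Fact q.Prime, WanPrime W p q ∧ (q : ℤ) ∣ NumberField.discr K ∧
      ∀ ℓ : ℕ, ℓ.Prime → ℓ ∣ W.conductorNorm ℤ → ℓ ≠ q →
        ((Ideal.span {(ℓ : ℤ)}).primesOver (𝓞 K)).ncard = 2) ∧
    (¬ 2 ∣ W.conductorNorm ℤ → ((Ideal.span {(2 : ℤ)}).primesOver (𝓞 K)).ncard = 2) ∧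
    SatisfiesHeegnerHypothesis p K

/-- The printed theorems the road consumes BY NAME (cite-only conjunction; same status as the route's
`PrintedFacts`): F6 (Friedberg–Hoffstein Thm B second alternative with Castella–Wan's local data /
Bump–Friedberg–Hoffstein 1990 road R2); the parity fact; entire continuation; GZK over `ℚ`
(`rank = r_an ≤ 1`, `Ш` finite); Cassels' isogeny invariance; a modular parametrisation; Gross–Zagier
I.(7.3) (rationality of `#Ш_an` in rank one); Skinner–Urban 2014 Thm 2 (a) (`padicValRat_bsd_rank_zero`);
Cai–Shu–Tian 2014 Thm 1.1 for the trivial character (field 1) AND for a ring class character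
(`thm11_ringClassChar`, field 2: the genus character of `K″`, `c = 1`); Gross 2004 §2 (v3: the Artin
factorisation `L(s, φ_{E′}, χ) = L(E′^{(d₁)}, s)·L(E′^{(d₂)}, s)` for a rational ring class character,
`rankinLSeries_eq_mul_quadraticTwist`); Voight 2007 Prop. 3.8 (genus theory of ring class fields:
`√d₁ ∈ H″`); Mazur 1978 Cor. 4.1 (`mazur_not_dvd_maninConstant_of_odd`: `p` odd, `p² ∤ N_{E′}` ⟹ `p ∤ c`
for the optimal datum — here `p ∤ N_{E′}`); Hsieh 2014 Thm B and Liu–Zhang–Zhang 2018 Thm 1.5.1+1.5.3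
with one `K`-ramified Steinberg prime (the sibling's branch-socket inputs); v4: Hoffstein–Luo 1997, Theorem,
for the newform of an elliptic curve (F7 `HoffsteinLuo1997_exists_twist_L_one_ne_zero`: field 2's
non-vanishing VALUE with prescribed splitting, sign-agnostic — LAST conjunct, so every v3 projection
`.1`, `.2.1`, …, `.2.….2.1` of the first fourteen conjuncts is unchanged). -/
def PrintedFactsR0 : Prop :=
  friedbergHoffstein_exists_twist_simpleZero_ramifiedAt_splitAt ∧
    (∀ W : WeierstrassCurve ℚ,
      Literature.NumberTheory.EllipticCurves.even_analyticRank_iff_rootNumber_eq_one W) ∧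
    WeierstrassCurve.hasEntireLFunction_rat ∧
    Literature.NumberTheory.EllipticCurves.rank_eq_analyticRank_of_analyticRank_le_one ∧
    WeierstrassCurve.bsdRHS_eq_of_isIsogenous ∧
    Literature.NumberTheory.EllipticCurves.ModularForms.nonempty_modularParametrizationData ∧
    Literature.NumberTheory.EllipticCurves.GrossZagier1986_thm_I_7_3 ∧
    Literature.NumberTheory.EllipticCurves.padicValRat_bsd_rank_zero ∧
    CaiShuTian2014.thm11_trivialChar ∧
    CaiShuTian2014.thm11_ringClassChar ∧
    Gross2004.rankinLSeries_eq_mul_quadraticTwist ∧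
    Voight2007.prop38_sqrt_mem_ringClassField_iff ∧
    mazur_not_dvd_maninConstant_of_odd ∧
    Hsieh2014.thmB_exists_isHsiehLFunction_coeff_norm_eq_one_unrPeriod_ramifiedSteinberg ∧
    LiuZhangZhang2018.thm151_thm153_modularCurve_heegnerVector_additive_ramifiedSteinberg ∧
    Literature.NumberTheory.EllipticCurves.HoffsteinLuo1997_exists_twist_L_one_ne_zero

/-- **TWIST-UNIT SUPPLY DATUM at `(Wd, p)`** (v2: the exact datum of the tree door
`HeegnerKolyvagin.missingUpperBoundAt_rankOne_istar_of_twistShaAnUnit`, member `Wd` ITSELF): an imaginary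
quadratic `K‴ = ℚ(√d)` satisfying the STRICT Heegner hypothesis for `N_{Wd}` (every prime of the conductor
split — so the additive prime `p` splits; `p² ∣ N_{Wd}` allowed), `L(Wd^{(d)}, 1) ≠ 0`, and a globally
minimal model `B` of `Wd^{(d)}` whose `#Ш_an` is a rational of non-positive `p`-adic valuation (`L ≠ 0` kept
explicitly: the junk value `padicValRat p 0 = 0` must not count). Per pair a finite exact certificate
(one twist's `L(B,1)/Ω_B` by modular symbols, torsion, Tamagawa). v1's clauses `Odd d`, `d < −4` dropped (unused
by the door). [cite: GrossZagier1986, Thm. I.(6.3)] [cite: McCallumLMS1991, §1 Theorem (Kolyvagin), p. 296] -/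
def TwistUnitSupplyDatum (Wd : WeierstrassCurve ℚ) [Wd.IsElliptic] (p : ℕ) [Fact p.Prime] : Prop :=
  ∃ (K : Type) (_ : Field K) (_ : NumberField K) (B : WeierstrassCurve ℚ) (_ : B.IsElliptic)
    (_ : B.IsGloballyMinimal),
    IsImaginaryQuadratic K ∧
    SatisfiesHeegnerHypothesis (Wd.conductorNorm ℤ) K ∧
    (Wd.quadraticTwist (NumberField.discr K : ℚ)).entireLFunction 1 ≠ 0 ∧
    (∃ C : VariableChange ℚ, C • Wd.quadraticTwist (NumberField.discr K : ℚ) = B) ∧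
    ∃ qd : ℚ, shaAn B = (qd : ℂ) ∧ padicValRat p qd ≤ 0

/-- The printed theorems this road consumes BY NAME: the sibling line's `PrintedFactsR0` (F6, parity,
Version L, GZK, Cassels, a parametrisation, GZ I.(7.3), Skinner–Urban, CST ×2, Gross 2004, Voight,
Mazur, Hsieh, LZZ, Hoffstein–Luo — only F6/parity/Version L/GZK/Cassels/parametrisation/GZ I.(7.3)/Mazur
and the branch-socket inputs are used here) AND: Gross–Zagier ∀ (`gross_zagier`), Kolyvagin ∀
(`kolyvagin`: rank one and `Ш(E/K)` finite at a non-torsion Heegner point), Matar–Nekovář 2019 Thm 0.7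
(irreducible form; unused in v2, kept for projection stability), Abbes–Ullmo and Česnavičius (Manin at primes
`∥ N` / at `2`, the inputs of the tree's `I_n*` Manin theorem), the newform of a parametrisation
(`exists_isNewformOf`), and — v2, LAST conjunct — Kolyvagin 1990 Thm A / McCallum 1991 §1, the `p`-EXACT bound
`ord_p #Ш(E/K) ≤ 2·ord_p [E(K) : ℤ y_K]` over a strict Heegner field, `p` odd, `ρ̄_{E,p}` onto
(`Kolyvagin1990_padicValNat_card_sha_le`; already a PUB input of the cell's Part 23b doors). LAST-conjunct
convention as in v4 (projections of `PrintedFactsR0` and of v1's `PrintedFactsTU` unchanged).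
[cite-only conjunction] [cite: McCallumLMS1991, §1 Theorem (Kolyvagin), p. 296] -/
def PrintedFactsTU : Prop :=
  PrintedFactsR0 ∧
    (∀ (N : ℕ) [NeZero N] (W : WeierstrassCurve ℚ) (K : Type) [Field K] [NumberField K],
      gross_zagier N W K) ∧
    (∀ (N : ℕ) [NeZero N] (W : WeierstrassCurve ℚ) (K : Type) [Field K] [NumberField K],
      kolyvagin N W K) ∧
    MatarNekovar2019.thm07_padicValNat_card_sha_primary_add_le_of_globalDivisibility_of_irreducible ∧
    abbesUllmo_not_dvd_maninConstant_of_not_dvd_level ∧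
    cesnavicius_not_two_dvd_maninConstant_of_two_dvd_level ∧
    exists_isNewformOf ∧
    (∀ (N : ℕ) [NeZero N] (W : WeierstrassCurve ℚ) (K : Type) [Field K] [NumberField K],
      Kolyvagin1990_padicValNat_card_sha_le N W K)

/-! ### Registered stubs (the ONLY sorried declarations) -/

/-- stub (residualR0) — VERBATIM `ThreeFieldRoad.stub_residualR0` (shared; one proof closes both): the
rank-`0` off-Case-1 rows OUTSIDE the sub-row (`p = 3`; `ρ̄` not onto; a second additive prime; no Wan
prime; `p ∣ v_ℓ(Δ)` at a split multiplicative `ℓ`) — the route's `λ`-parity road (children 19244/19245)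
or Jetchev-type Tamagawa removal. The residual piece; not this line's content. [XL, open-problem] -/
theorem stub_residualR0 :
    ∀ (W : WeierstrassCurve ℚ) [W.IsElliptic] [W.IsGloballyMinimal] (p : ℕ) [Fact p.Prime],
      W.analyticRank = 0 → N10.CellGordTwo W p → ¬ HasCaseOneMember W p →
        ¬ ThreeFieldRow W p → MissingLowerBoundAt W p := by
  sorry

/-- stub (printedFactsTU) — cite-only (see `PrintedFactsTU`). [cite-only] -/
theorem stub_printedFactsTU : PrintedFactsTU := by
  sorry

/-- stub (fieldSupplyTU) — FIELD 1 ONLY: on the sub-row in analytic rank `0`, a tame-road field `K` and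
a globally minimal model `Wd` of `E^{(d_K)}` with `r_an(Wd) = 1`, again a (G-ord, `e = 2`) pair at `p`
with `ρ̄` onto and `p ∤ ∏ c_ℓ(Wd)`. = the first six clauses of `ThreeFieldRoad.stub_fieldSupplyR0` (v4;
stub-worker w2): F6 `friedbergHoffstein_exists_twist_simpleZero_ramifiedAt_splitAt` applied to
`V = E^{(p*)}_min` with `S = ` the primes of `N_V` minus the Wan prime `q` (split), `R = {q}` (ramified),
`I = {p}` (inert), `L(V^{(d)},1)·` simple zero of the twist ⟹ `r_an(Wd) = 1` (parity + GZK bookkeeping);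
cell / surjectivity / Tamagawa transport across the twist at primes `ℓ ≠ p` split in `K`
(`hasReductionAt_quadraticTwist_iff_of_not_dvd`, `c_ℓ(Wd) = c_ℓ(E)`), `c ≤ 4 < p` at the additive
primes of `Wd`. A proof of w2's v4 stub proves this one by projection. [M] -/
theorem stub_fieldSupplyTU : PrintedFactsR0 →
    ∀ (W : WeierstrassCurve ℚ) [W.IsElliptic] [W.IsGloballyMinimal] (p : ℕ) [Fact p.Prime],
      W.analyticRank = 0 → N10.CellGordTwo W p → ThreeFieldRow W p →
        ∃ (K : Type) (_ : Field K) (_ : NumberField K)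
          (Wd : WeierstrassCurve ℚ) (_ : Wd.IsElliptic) (_ : Wd.IsGloballyMinimal),
          TameRoadField W p K ∧
          (∃ C : WeierstrassCurve.VariableChange ℚ, C • W.quadraticTwist (NumberField.discr K : ℚ) = Wd) ∧
          Wd.analyticRank = 1 ∧ N10.CellGordTwo Wd p ∧ Surj Wd p ∧ ¬ p ∣ Wd.tamagawaProduct := by
  sorry

/-- stub (tameJointLowerR0) — VERBATIM `ThreeFieldRoad.stub_tameJointLowerR0` (shared; one proof closes
both): THE TAME ROAD WITH THE RANKS SWAPPED — on the sub-row in analytic rank `0`, at a tame-road field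
`K` with `r_an(E^{(d_K)}) = 1`, the JOINT LOWER half `ord_p #Ш_an(E) + ord_p #Ш_an(Wd) ≤ ord_p #Ш(E) +
ord_p #Ш(Wd)` (Wan 2015 Thm 1.1 (1) ∘ Hsieh Thm B ∘ PORT-1 ∘ LZZ ⟹ `BranchSocketAt`; CST Thm 1.1 +
anticyclotomic control ⟹ `TameStepLAt`; GZ bookkeeping, `Ш(E/K)[p^∞] ≅ Ш(E) ⊕ Ш(Wd)`).
[XL; by transfer from the registered rank-one line] -/
theorem stub_tameJointLowerR0 : PrintedFactsR0 →
    ∀ (W : WeierstrassCurve ℚ) [W.IsElliptic] [W.IsGloballyMinimal] (p : ℕ) [Fact p.Prime]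
      (K : Type) [Field K] [NumberField K] (Wd : WeierstrassCurve ℚ) [Wd.IsElliptic] [Wd.IsGloballyMinimal],
      W.analyticRank = 0 → N10.CellGordTwo W p → ThreeFieldRow W p → TameRoadField W p K →
        (∃ C : WeierstrassCurve.VariableChange ℚ, C • W.quadraticTwist (NumberField.discr K : ℚ) = Wd) →
        Wd.analyticRank = 1 → JointLowerBoundAt W Wd p := by
  sorry

/-- stub (twistUnitSupply) — THE RESIDUAL OF THIS LINE (its one non-printed input): every rank-one
(G-ord, `e = 2`) curve `Wd` at `p ≥ 5` with `ρ̄_{Wd,p}` onto has a twist-unit supply datum — a strict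
Heegner field `ℚ(√d)` for `N_{Wd}` (`d < −4` odd, all primes of `N_{Wd}` split) with `L(Wd^{(d)},1) ≠ 0`
and `ord_p #Ш_an(Wd^{(d)}_min) ≤ 0`. WHY PLAUSIBLE: Kolyvagin's conjecture with a `p`-unit / Ono–Skinner
1998 Cor. 2, 4 (mod-`ℓ` non-vanishing of `#Ш_an` of twists with Kolyvagin's prescribed local conditions,
for every `ℓ` outside an effectively determinable finite set) — whose hypotheses (L1)–(L2) (`ℓ ∤ 4N`,
`ℓ > 2(k+2)`) EXCLUDE the additive prime `ℓ = p ∣ N_{Wd}`: NOT in print on these rows; heuristically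
(Delaunay) the unit twists have density `1 − O(1/p)` in every square class. WHY IT MIGHT FAIL: only if
some `(Wd, p)` had `p ∣ #Ш_an` for EVERY Heegner twist — not excluded by any theorem; per pair decidable
(finite exact certificate: one twist's `L(B,1)/Ω_B` by modular symbols, torsion, Tamagawa), so a census
is the kill path / bc5 witness. [XL; open class-wide; cite: Ono–Skinner 1998 (doi:10.2307/121015,
arXiv:math/9611225) Cor. 2, Cor. 4, (L1)–(L2); Bruinier 1999 (doi:10.1215/S0012-7094-99-09819-8) Thm 2
(`p ∤ M`); survey doi:10.1007/978-1-4613-0305-3_6 p. 7 Cor. 5] -/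
theorem stub_twistUnitSupply :
    ∀ (Wd : WeierstrassCurve ℚ) [Wd.IsElliptic] [Wd.IsGloballyMinimal] (p : ℕ) [Fact p.Prime],
      5 ≤ p → Wd.analyticRank = 1 → N10.CellGordTwo Wd p → Surj Wd p →
        TwistUnitSupplyDatum Wd p := by
  sorry

/-! ### The print port, PROVED (v1's `stub_upperOfTwistUnit`; no sorry) -/

/-- **UPPER(`Wd`) from a twist-unit supply datum and PRINT BY NAME** — the UPPER half
`ord_p #Ш(Wd) ≤ ord_p #Ш_an(Wd)` of a rank-one (G-ord, `e = 2`) curve with `ρ̄_{Wd,p}` onto, `p ≥ 5`,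
`p ∤ ∏ c_ℓ(Wd)`: literally the cell's tree theorem
`HeegnerKolyvagin.missingUpperBoundAt_rankOne_cellGordTwo_odd_of_twistShaAnUnit` (Part 23c §17; JSW 2017 §7.4.2
bookkeeping at `p² ∣ N`: Kolyvagin–McCallum's `p`-exact bound over the split strict Heegner field `K‴` at a
Manin-good Heegner datum — Kodaira `Iₙ*` at `p` ⟹ `p ∤ c` by Mazur–Stevens/Edixhoven/Abbes–Ullmo/Česnavičius —,
Gross–Zagier, the twist's LOWER half free on its unit window, `ord_p ∏c(B) = ord_p ∏c(Wd)`, `p ∤ #𝓞_{K‴}^×`),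
fed with the conjuncts of `PrintedFactsTU`. [cite: JetchevSkinnerWan2017, §7.4.2 (eq:shaupper), p. 31]
[cite: McCallumLMS1991, §1 Theorem (Kolyvagin), p. 296] [cite: GrossZagier1986, Thm. I.(6.3)]
[cite: Mazur1978, Cor. 4.1] [cite: AbbesUllmo1996, Thm. A] [cite: Cesnavicius2018, Thm. 1.2] -/
theorem upperOfTwistUnit_of_print : PrintedFactsTU →
    ∀ (Wd : WeierstrassCurve ℚ) [Wd.IsElliptic] [Wd.IsGloballyMinimal] (p : ℕ) [Fact p.Prime],
      5 ≤ p → Wd.analyticRank = 1 → N10.CellGordTwo Wd p → Surj Wd p → ¬ p ∣ Wd.tamagawaProduct →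
        TwistUnitSupplyDatum Wd p → MissingUpperBoundAt Wd p := by
  intro hF Wd _ _ p _ _ hr hc hs ht hTU
  obtain ⟨hR0, hGZ, hKo, -, hAU, hC2, hnf, hB⟩ := hF
  obtain ⟨-, -, hmod, hGZK, -, -, -, -, -, -, -, -, hMz, -⟩ := hR0
  obtain ⟨K, iF, iNF, B, iB, iBm, hK, hH, hL, ⟨C, hC⟩, qd, hqd, hvd⟩ := hTU
  exact AdditiveBranchIMCGordTwoRankOne.HeegnerKolyvagin.missingUpperBoundAt_rankOne_cellGordTwo_odd_of_twistShaAnUnit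
    hGZ hKo hB hGZK hmod hnf hMz hAU hC2 Wd p K B C hr hc hs ht hK hH hL hC hqd hvd

/-! ### The composition (kernel-checked, no sorry of its own) -/

/-- THE SKELETON: the crux `GordTwoRankZeroOffCaseOne` BY NAME from exactly the five registered stubs —
by cases on «the curve lies on the three-field sub-row»; on it, field 1 gives `(K, Wd)` and the joint
lower half of the pair, the supply gives `Wd` a twist-unit datum, the PROVED print port `upperOfTwistUnit_of_print` gives the
UPPER half of `Wd`, and `Typed.missingLowerBoundAt_of_joint_of_upper` finishes; off it, the residual stub. -/
theorem GordTwoRankZeroOffCaseOne_of : GordTwoRankZeroOffCaseOne := by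
  intro W _ _ p _ hr hcell hc1
  by_cases hs : ThreeFieldRow W p
  · have hF0 : PrintedFactsR0 := stub_printedFactsTU.1
    obtain ⟨K, iF, iNF, Wd, iWd, iWdm, hK, htw, hrd, hcelld, hsurjd, htamd⟩ :=
      stub_fieldSupplyTU hF0 W p hr hcell hs
    have h5 : 5 ≤ p := hs.1.1
    -- field 1: the joint lower half from the tame road with the ranks swapped
    have hJ : JointLowerBoundAt W Wd p :=
      stub_tameJointLowerR0 hF0 W p K Wd hr hcell hs hK htw hrd
    -- the twist-unit supply at the rank-one twist and the printed upper half
    have hTU : TwistUnitSupplyDatum Wd p := stub_twistUnitSupply Wd p h5 hrd hcelld hsurjd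
    have hU : MissingUpperBoundAt Wd p :=
      upperOfTwistUnit_of_print stub_printedFactsTU Wd p h5 hrd hcelld hsurjd htamd hTU
    exact missingLowerBoundAt_of_joint_of_upper hJ hU
  · exact stub_residualR0 W p hr hcell hc1 hs

end Summit.BirchSwinnertonDyer.BirchSwinnertonDyer.Cruxes.GordTwoRankZeroOffCaseOne.TwistUnitRoad
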